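import Mathlib.AlgebraicGeometry.Noetherian
import Literature.AlgebraicGeometry.HilbertScheme.HilbertSchemeOfPoints
import Literature.AlgebraicGeometry.ModuliOfSheaves.HilbertSchemeOfPoints
import HarnessLib

/-!
# The two renderings of "`(H, Ξ)` is the Hilbert scheme of `n` points" agree on schemes of finite type

The tree carries two predicates for the Hilbert scheme of `n` points of a `k`-scheme `S`, written
the same day for the same definition item (`defn-IsOfK3HilbertSquareType`) on the same carriers
(`k`-schemes `Motives.SchemeOver k = Over (Spec k)` with their cartesian monoidal structure, closed
subschemes of `S ×_k U` as ideal sheaves `(S ⊗ U).left.IdealSheafData`, base change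
`Z.comap (S ◁ f).left`):

* `HilbertScheme.IsHilbertSchemeOfPoints n S H Ξ` (`HilbertScheme/HilbertSchemeOfPoints`, after
  Stacks 0B94): `Ξ → H` finite locally free of degree `n` (finite, flat, locally of finite
  presentation, rank `n`), and the universal property for ALL `k`-schemes `T`;
* `ModuliOfSheaves.IsHilbertSchemeOfPoints n S H Ξ` (`ModuliOfSheaves/HilbertSchemeOfPoints`,
  after Göttsche Def. 1.1.1–1.1.3): `H` locally of finite type, `Ξ → H` "flat of degree `n`"
  (finite, flat, rank `n`), and the universal property for test schemes `U` LOCALLY OF FINITE TYPE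
  over `k` (Göttsche/Grothendieck: locally noetherian test schemes).

This file PROVES that the first implies the second as soon as `H` is locally of finite type
(`IsHilbertSchemeOfPoints.toModuliOfSheaves`), via the observation that over a test scheme locally
of finite type over a field — hence locally noetherian — "finite, flat, rank `n`" and "finite
locally free of degree `n`" coincide (Stacks 02KB (3): over a locally noetherian base finite + flat
= finite locally free; Mathlib: locally of finite type over a locally noetherian scheme is locally of
finite presentation), `mem_hilbertFunctorOfPoints_iff_isFlatOfDegree`. The converse implication is
not available (the second predicate only knows test schemes of finite type). Consumers holding a
`K3^[n]`-type datum (`Hyperkaehler.IsOfK3HilbertType`, whose model `H = S₀^[n]` is smooth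
projective, hence locally of finite type: `IsOfK3HilbertType.exists_isSmoothProjective`) can thus
use the named facts stated against either predicate (e.g. `Hyperkaehler/K3HilbertSchemeBeauville`).

Sources: The Stacks Project, Tag 0B94 (Hilbert functor of points) and Tag 02KB (finite locally free
⟺ finite + flat + locally of finite presentation; over a locally noetherian base ⟺ finite + flat);
L. Göttsche, LNM 1572, Def. 1.1.1–1.1.3.
-/

noncomputable section

open CategoryTheory Limits MonoidalCategory AlgebraicGeometry

universe u

namespace Literature.AlgebraicGeometry.HilbertScheme

variable {k : Type u} [Field k] {n : ℕ} {S U H : Motives.SchemeOver k}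

/-- A member of `Hilb^n_{S/k}(U)` is "flat of degree `n` over `U`" in the sense of
`ModuliOfSheaves.IsFlatOfDegree` (forget finite presentation). [cite: StacksProject, Tag 02KB] -/
theorem isFlatOfDegree_of_mem {Z : (S ⊗ U).left.IdealSheafData}
    (h : Z ∈ hilbertFunctorOfPoints n S U) : ModuliOfSheaves.IsFlatOfDegree n Z :=
  (ModuliOfSheaves.isFlatOfDegree_iff n Z).mpr ⟨h.isFinite, h.flat, h.finrank_eq⟩

/-- **Over a test scheme locally of finite type over a field the two degree-`n` conditions agree**:
`Z ⊂ S ×_k U` is finite locally free of degree `n` over `U` (membership in `Hilb^n_{S/k}(U)`) iff it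
is finite, flat and of rank `n` over `U` (`ModuliOfSheaves.IsFlatOfDegree`) — `U` is locally
noetherian (Mathlib `LocallyOfFiniteType.isLocallyNoetherian`), and over a locally noetherian scheme
a morphism locally of finite type is locally of finite presentation.
[cite: StacksProject, Tag 02KB] -/
theorem mem_hilbertFunctorOfPoints_iff_isFlatOfDegree [LocallyOfFiniteType U.hom]
    (Z : (S ⊗ U).left.IdealSheafData) :
    Z ∈ hilbertFunctorOfPoints n S U ↔ ModuliOfSheaves.IsFlatOfDegree n Z := by
  refine ⟨isFlatOfDegree_of_mem, fun h ↦ ?_⟩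
  obtain ⟨hfin, hflat, hrk⟩ := (ModuliOfSheaves.isFlatOfDegree_iff n Z).mp h
  haveI := hfin
  haveI := hflat
  haveI : IsLocallyNoetherian U.left := LocallyOfFiniteType.isLocallyNoetherian U.hom
  exact ⟨hfin, hflat, inferInstance, hrk⟩

/-- **The Stacks-style Hilbert scheme of points is a Göttsche-style one.** If `(H, Ξ)` represents
`Hilb^n_{S/k}` on all `k`-schemes (`HilbertScheme.IsHilbertSchemeOfPoints`) and `H` is locally of
finite type over `k` (true for the genuine `S^[n]` of a projective `S`, which is projective), then
`(H, Ξ)` satisfies `ModuliOfSheaves.IsHilbertSchemeOfPoints` (universal property on test schemes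
locally of finite type). [cite: StacksProject, Tag 0B94] [cite: Gottsche1993, Def. 1.1.3] -/
theorem IsHilbertSchemeOfPoints.toModuliOfSheaves {Ξ : (S ⊗ H).left.IdealSheafData}
    (h : IsHilbertSchemeOfPoints n S H Ξ) (hH : LocallyOfFiniteType H.hom) :
    ModuliOfSheaves.IsHilbertSchemeOfPoints n S H Ξ where
  locallyOfFiniteType := hH
  isFlatOfDegree := isFlatOfDegree_of_mem h.mem
  exists_eq_hilbertPullback U hU Z hZ := by
    haveI := hU
    obtain ⟨f, hf, -⟩ :=
      h.existsUnique_hom U Z ((mem_hilbertFunctorOfPoints_iff_isFlatOfDegree Z).mpr hZ)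
    exact ⟨f, hf.symm⟩
  eq_of_hilbertPullback_eq U _ f g hfg := h.hom_ext hfg

/-- Conversely, a Göttsche-style Hilbert scheme of points has the universal property of
`Hilb^n_{S/k}` for every test scheme locally of finite type: unique classifying morphisms for the
members of `hilbertFunctorOfPoints n S U`. [cite: Gottsche1993, Def. 1.1.3] -/
theorem existsUnique_hom_of_moduliOfSheaves {Ξ : (S ⊗ H).left.IdealSheafData}
    (h : ModuliOfSheaves.IsHilbertSchemeOfPoints n S H Ξ) {U : Motives.SchemeOver k}
    [hU : LocallyOfFiniteType U.hom] {Z : (S ⊗ U).left.IdealSheafData}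
    (hZ : Z ∈ hilbertFunctorOfPoints n S U) : ∃! f : U ⟶ H, Ξ.comap (S ◁ f).left = Z := by
  obtain ⟨f, hf, hu⟩ := h.existsUnique hU (isFlatOfDegree_of_mem hZ)
  exact ⟨f, hf.symm, fun g hg ↦ hu g hg.symm⟩

end Literature.AlgebraicGeometry.HilbertScheme
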